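import Literature.AlgebraicTopology.Homotopy.InfiniteCellAttachment
import HarnessLib

/-!
# When is the adjunction space `Z ∪_φ ⊔ᵢ Dᵈ` nonempty?

Topic `Literature/AlgebraicTopology/Homotopy`. Nonemptiness bookkeeping (carrier witness) for the
adjunction space `CellAttach.Space φ` of `InfiniteCellAttachment.lean`: a space `Z` with a family
of `d`-discs `(Dᵈ)_{i : ι}` attached along maps `φᵢ : S^{d-1} → Z` (Hatcher, *Algebraic Topology*
(2002), Ch. 0 p. 5 and p. 7, "attaching cells"). Its points in normal form are `Z ⊔ ⊔ᵢ Bᵈ` with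
`Bᵈ` the OPEN unit disc of `ℝᵈ`, and `Bᵈ` always contains its centre `0` (also for `d = 0`, where
`B⁰ = ℝ⁰` is a point). Hence, all PROVED:

* `CellAttach.nonempty_space_iff` — `Z ∪_φ ⊔ᵢ Dᵈ` is nonempty iff `Z` is nonempty or `ι` is
  nonempty, with the explicit inhabitants `inZ φ z` (a base point) resp. `chi φ i 0` (the centre
  of the `i`-th cell); `CellAttach.Space_nonempty` is the carrier witness over exactly this
  region (`Space_nonempty_of_base`, `Space_nonempty_of_index` the two instance-argument forms; the
  `Nonempty` instance from `[Nonempty Z]` is `CellAttach.instNonempty` of the parent file);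
* `CellAttach.isEmpty_space_iff`, `CellAttach.Space_isEmpty` — **the space is EMPTY exactly when
  `Z` and `ι` are both empty** (nothing attached to the empty space), a region inhabited by actual
  parameters, e.g. `Z = ι = PEmpty` in every dimension (`Space_isEmpty_pempty`); so
  "`∀ params, Nonempty (Space params)`" is false (`not_forall_nonempty_space`), and a statement
  quantifying universally over the points of the space is vacuous at such parameters;
* the rôle of the dimension: for `d ≥ 1` the attaching sphere `S^{d-1}` is nonempty
  (`sphere_nonempty_of_pos`), so one attached disc already forces `Z ≠ ∅` (`nonempty_of_index`)
  and (non)emptiness of `Z ∪_φ ⊔ᵢ Dᵈ` is equivalent to that of `Z`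
  (`nonempty_space_iff_of_pos`, `isEmpty_space_iff_of_pos`); for `d = 0` the sphere `S⁻¹ ⊆ ℝ⁰`
  is empty (`sphere_zero_eq_empty`), every `Z` — even `Z = ∅` — admits exactly one family of
  attaching maps (`nonempty_sphereZeroMap`, `subsingleton_sphereZeroMap`), and `∅ ∪ ⊔ᵢ D⁰` is the
  set `ι` of `0`-cells (Hatcher p. 5: "`X⁰` is a discrete set, whose points are regarded as
  `0`-cells"), nonempty as soon as `ι` is (`exists_nonempty_space_of_isEmpty_base`).

No definitions, no named facts, no `sorry`.

## References

* A. Hatcher, *Algebraic Topology*, CUP (2002), Ch. 0 pp. 5, 7. [HatcherAT2002]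
-/

noncomputable section

open Set Function Metric

universe u w

namespace Literature.AlgebraicTopology.Homotopy

namespace CellAttach

variable {Z : Type u} [TopologicalSpace Z] {ι : Type w} {d : ℕ}
  (φ : ι → C(↥(sphere (0 : Fin d → ℝ) 1), Z))

/-! ### Explicit inhabitants -/

/-- The centre `0` of the model disc lies in the open unit disc `Bᵈ` — in every dimension, also
`d = 0`. [folklore] -/
theorem zero_mem_ball : (0 : Fin d → ℝ) ∈ ball (0 : Fin d → ℝ) 1 := mem_ball_self one_pos

/-- **The centre of the `i`-th cell**, `chi φ i 0`, is the normal-form point `(i, 0)` of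
`Z ∪_φ ⊔ᵢ Dᵈ`: an explicit inhabitant available as soon as one disc is attached. [folklore] -/
theorem chi_zero (i : ι) : chi φ i 0 = ofBall φ i ⟨0, zero_mem_ball⟩ :=
  chi_of_mem_ball φ i zero_mem_ball

/-- The centre of a cell is not a point of the base `Z`. [folklore] -/
theorem chi_zero_ne_inZ (i : ι) (z : Z) : chi φ i 0 ≠ inZ φ z :=
  chi_ne_inZ φ i zero_mem_ball z

/-- Distinct cells have distinct centres. [folklore] -/
theorem chi_zero_injective : Injective fun i : ι => chi φ i 0 := fun _ _ h =>
  ((chi_eq_chi_iff φ zero_mem_ball zero_mem_ball).1 h).1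

/-! ### Nonemptiness: the exact region -/

/-- **`Z ∪_φ ⊔ᵢ Dᵈ` is nonempty iff `Z` is nonempty or some disc is attached**: its points are
`Z ⊔ ⊔ᵢ Bᵈ` and each open disc contains its centre. [folklore] -/
theorem nonempty_space_iff : Nonempty (Space φ) ↔ Nonempty Z ∨ Nonempty ι := by
  constructor
  · rintro ⟨⟨z | ⟨i, _⟩⟩⟩
    · exact Or.inl ⟨z⟩
    · exact Or.inr ⟨i⟩
  · rintro (⟨⟨z⟩⟩ | ⟨⟨i⟩⟩)
    · exact ⟨inZ φ z⟩
    · exact ⟨chi φ i 0⟩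

/-- **`Z ∪_φ ⊔ᵢ Dᵈ` is empty iff `Z` and `ι` are both empty.** [folklore] -/
theorem isEmpty_space_iff : IsEmpty (Space φ) ↔ IsEmpty Z ∧ IsEmpty ι := by
  simp only [← not_nonempty_iff, nonempty_space_iff, not_or]

/-- **Carrier witness.** The adjunction space `Z ∪_φ ⊔ᵢ Dᵈ` is nonempty over exactly the parameter
region `Nonempty Z ∨ Nonempty ι` (`nonempty_space_iff`), with the explicit inhabitants `inZ φ z`
(a base point) resp. `chi φ i 0` (the centre of an attached cell). It is NOT nonempty at all
parameters: `Space_isEmpty`, `not_forall_nonempty_space`. [folklore] -/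
theorem Space_nonempty (h : Nonempty Z ∨ Nonempty ι) : Nonempty (Space φ) :=
  (nonempty_space_iff φ).2 h

/-- The carrier witness from a base point: `inZ φ z`. [folklore] -/
theorem Space_nonempty_of_base [Nonempty Z] : Nonempty (Space φ) :=
  ⟨inZ φ (Classical.arbitrary Z)⟩

/-- The carrier witness from an attached disc: the centre `chi φ i 0` of its cell. [folklore] -/
theorem Space_nonempty_of_index [Nonempty ι] : Nonempty (Space φ) :=
  ⟨chi φ (Classical.arbitrary ι) 0⟩

/-- **The vacuous region.** With nothing to attach to and nothing attached — `Z` empty AND `ι`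
empty — the adjunction space `Z ∪_φ ⊔ᵢ Dᵈ` is EMPTY, so every statement quantifying universally
over its points is vacuous there; by `isEmpty_space_iff` this is the exact region. [folklore] -/
theorem Space_isEmpty [IsEmpty Z] [IsEmpty ι] : IsEmpty (Space φ) :=
  (isEmpty_space_iff φ).2 ⟨‹_›, ‹_›⟩

/-- The vacuous region is inhabited by actual parameters: attaching no discs (`ι = PEmpty`) to the
empty space (`Z = PEmpty`) along the empty family of attaching maps gives the empty space, in every
dimension `d`. [folklore] -/
theorem Space_isEmpty_pempty (d : ℕ) :
    IsEmpty (Space fun i : PEmpty.{w + 1} =>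
      (i.elim : C(↥(sphere (0 : Fin d → ℝ) 1), PEmpty.{u + 1}))) :=
  Space_isEmpty _

/-- Hence the carrier `CellAttach.Space` is not nonempty at all parameters. [folklore] -/
theorem not_forall_nonempty_space (d : ℕ) :
    ¬ ∀ (Z : Type u) [TopologicalSpace Z] (ι : Type w)
      (φ : ι → C(↥(sphere (0 : Fin d → ℝ) 1), Z)), Nonempty (Space φ) := by
  intro h
  obtain ⟨⟨z | ⟨i, -⟩⟩⟩ := h PEmpty PEmpty fun i => i.elim
  · exact z.elim
  · exact i.elim

/-! ### The rôle of the dimension -/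

/-- For `d ≥ 1` the model sphere `S^{d-1} ⊆ ℝᵈ` (sup norm) is nonempty: the constant vector `1`
has norm `1`. [folklore] -/
theorem sphere_nonempty_of_pos (hd : 0 < d) : (sphere (0 : Fin d → ℝ) 1).Nonempty := by
  haveI : Nonempty (Fin d) := ⟨⟨0, hd⟩⟩
  exact ⟨fun _ => 1, by rw [mem_sphere_zero_iff_norm, pi_norm_const, norm_one]⟩

include φ in
/-- **For `d ≥ 1` an attached disc forces a base point**: the attaching map `φ i : S^{d-1} → Z`
has nonempty domain, so `Z ≠ ∅`. [folklore] -/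
theorem nonempty_of_index (hd : 0 < d) (i : ι) : Nonempty Z :=
  let ⟨y, hy⟩ := sphere_nonempty_of_pos hd
  ⟨φ i ⟨y, hy⟩⟩

include φ in
/-- For `d ≥ 1`, with `Z` empty no disc can be attached: the index type is empty too. [folklore] -/
theorem isEmpty_index_of_pos (hd : 0 < d) [IsEmpty Z] : IsEmpty ι :=
  ⟨fun i => (nonempty_of_index φ hd i).elim fun z => isEmptyElim z⟩

/-- **For `d ≥ 1`, `Z ∪_φ ⊔ᵢ Dᵈ` is nonempty iff `Z` is.** [folklore] -/
theorem nonempty_space_iff_of_pos (hd : 0 < d) : Nonempty (Space φ) ↔ Nonempty Z := by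
  rw [nonempty_space_iff]
  exact ⟨fun h => h.elim id fun ⟨i⟩ => nonempty_of_index φ hd i, Or.inl⟩

/-- For `d ≥ 1`, `Z ∪_φ ⊔ᵢ Dᵈ` is empty iff `Z` is. [folklore] -/
theorem isEmpty_space_iff_of_pos (hd : 0 < d) : IsEmpty (Space φ) ↔ IsEmpty Z := by
  simp only [← not_nonempty_iff, nonempty_space_iff_of_pos φ hd]

/-- For `d = 0` the model sphere `S⁻¹ ⊆ ℝ⁰` is empty (`ℝ⁰` is one point, of norm `0 ≠ 1`).
[folklore] -/
theorem sphere_zero_eq_empty : sphere (0 : Fin 0 → ℝ) 1 = ∅ :=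
  Metric.sphere_eq_empty_of_subsingleton one_ne_zero

/-- For `d = 0` the model sphere has no points. [folklore] -/
theorem isEmpty_sphere_zero : IsEmpty ↥(sphere (0 : Fin 0 → ℝ) 1) :=
  Set.isEmpty_coe_sort.2 sphere_zero_eq_empty

/-- **Attaching `0`-cells needs no base point**: for `d = 0` every space `Z` — even `Z = ∅` —
receives an attaching map `S⁻¹ = ∅ → Z`, the empty map. [folklore] -/
theorem nonempty_sphereZeroMap (Z : Type u) [TopologicalSpace Z] :
    Nonempty C(↥(sphere (0 : Fin 0 → ℝ) 1), Z) :=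
  ⟨⟨fun y => isEmpty_sphere_zero.elim y,
    continuous_of_const fun y => isEmpty_sphere_zero.elim y⟩⟩

/-- For `d = 0` the attaching map into a given `Z` is unique. [folklore] -/
theorem subsingleton_sphereZeroMap (Z : Type u) [TopologicalSpace Z] :
    Subsingleton C(↥(sphere (0 : Fin 0 → ℝ) 1), Z) :=
  ⟨fun _ _ => ContinuousMap.ext fun y => isEmpty_sphere_zero.elim y⟩

/-- **The region `Z = ∅`, `ι ≠ ∅` is realised (in dimension `0` only, cf. `isEmpty_index_of_pos`)**:
attaching `0`-cells indexed by a nonempty `ι` to the empty space gives the nonempty (discrete) space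
`X⁰ = ι` of `0`-cells. [cite: HatcherAT2002, Ch. 0 p. 5] -/
theorem exists_nonempty_space_of_isEmpty_base (ι : Type w) [Nonempty ι] :
    ∃ φ : ι → C(↥(sphere (0 : Fin 0 → ℝ) 1), PEmpty.{u + 1}), Nonempty (Space φ) :=
  let ⟨f⟩ := nonempty_sphereZeroMap PEmpty.{u + 1}
  ⟨fun _ => f, Space_nonempty_of_index _⟩

/-- In dimension `0` both alternatives of `nonempty_space_iff` occur independently: for EVERY `Z`
and `ι` there are attaching data, and the resulting space of `Z` with the `0`-cells `ι` adjoined is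
nonempty iff `Z ⊕ ι` is. [folklore] -/
theorem exists_space_zero_nonempty_iff (Z : Type u) [TopologicalSpace Z] (ι : Type w) :
    ∃ φ : ι → C(↥(sphere (0 : Fin 0 → ℝ) 1), Z), (Nonempty (Space φ) ↔ Nonempty (Z ⊕ ι)) :=
  let ⟨f⟩ := nonempty_sphereZeroMap Z
  ⟨fun _ => f, by rw [nonempty_space_iff, nonempty_sum]⟩

end CellAttach

end Literature.AlgebraicTopology.Homotopy
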